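import Summits.RiemannHypothesis.RiemannHypothesis.Theorems.SemilocalLogAtomsB
import Summits.RiemannHypothesis.RiemannHypothesis.Theorems.SemilocalLogAtomsE
import HarnessLib

/-!
# Log-atom enclosures (M): the atoms `157`, `163`, `167`, `173` and the power atom `169 = 13²`

Cell `rh-explicit` (HOME `run/shared/lean/pub/rh-explicit/`), seat cc-s2-4 gen12 (A4 lane, the Lean side).  Sequel of
`SemilocalLogAtoms{,B,…,L}.lean`: the rational enclosures `(lo, hi, wlo, whi)` of `log p` and of the weights `log p/√p` for
`p = 157, 163, 167, 173` — the atoms (and, through the `lo` fields, the window-end bounds `log 163`, `log 167`, `log 173`) of the wall rows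
beyond `q = 157` (all KINKED items: `q = 163` (`S = {p ≤ 157}`, window `< (log 167)/2`), `q = 167` (`< (log 173)/2`), `q = 173`
(`< (log 179)/2`); CC4-LEAN §17.4: non-twin walls take ≈ 8–10 slope breaks) — 7-term log series (`Real.abs_log_sub_add_sum_range_le`) at
`157 = 156·(1 + 1/156)`, `163 = 162·(1 + 1/162)`, `167 = 168·(1 − 1/168)`, `173 = 175·(1 − 2/175)` with the tree's `log 2` (d20), `log 3`,
`log 5`, `log 7`, `log 13`; square roots by squaring; and the power atom `169 = 13²` (weight `log 13/13`), first needed at `N ≥ 169`.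

Folklore numerics throughout; nothing here bears on RH.
-/

set_option autoImplicit false
set_option linter.dupNamespace false  -- the mandated namespace repeats `RiemannHypothesis`

noncomputable section

namespace Summit.RiemannHypothesis.RiemannHypothesis.Theorems.SemilocalPolyWitness

open Real
open Literature.NumberTheory.LFunctions
open Literature.Analysis.SpecialFunctions.Real
open Summit.RiemannHypothesis.RiemannHypothesis.Theorems.MotivicDoor.SemilocalMarkov

/-! ### The atom `157` (`log 157` from `157 = 156·(1 + 1/156)`) -/

/-- `(5.05624580524) < log 157` (`Real.abs_log_sub_add_sum_range_le` at `x = -1/156`, 7 terms). -/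
theorem log_hundredfiftyseven_gt : (5.05624580524 : ℝ) < Real.log 157 := by
  have t : |(-(1 : ℝ) / 156)| < 1 := by rw [abs_of_neg (by norm_num)]; norm_num
  have z := Real.abs_log_sub_add_sum_range_le t 7
  rw [show |(-(1 : ℝ) / 156)| = 1 / 156 by rw [abs_of_neg (by norm_num)]; norm_num] at z
  norm_num [Finset.sum_range_succ] at z
  have e : Real.log (157 / 156) = Real.log 157 - (2 * Real.log 2 + Real.log 3 + Real.log 13) := by
    rw [Real.log_div (by norm_num) (by norm_num), show (156 : ℝ) = 2 ^ 2 * 3 * 13 by norm_num, Real.log_mul (by norm_num) (by norm_num), Real.log_mul (by norm_num) (by norm_num), Real.log_pow]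
    push_cast; ring
  rw [e] at z
  have h2 := Literature.Analysis.SpecialFunctions.Real.log_two_gt_d20
  have h3 := logThreeLo_le
  rw [logThreeLo] at h3
  push_cast at h3
  have h13 := logThirteenLo_le
  rw [logThirteenLo] at h13
  push_cast at h13
  obtain ⟨z1, z2⟩ := abs_le.1 z
  linarith

/-- `log 157 < 5.05624580546` (`Real.abs_log_sub_add_sum_range_le` at `x = -1/156`, 7 terms). -/
theorem log_hundredfiftyseven_lt : Real.log 157 < 5.05624580546 := by
  have t : |(-(1 : ℝ) / 156)| < 1 := by rw [abs_of_neg (by norm_num)]; norm_num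
  have z := Real.abs_log_sub_add_sum_range_le t 7
  rw [show |(-(1 : ℝ) / 156)| = 1 / 156 by rw [abs_of_neg (by norm_num)]; norm_num] at z
  norm_num [Finset.sum_range_succ] at z
  have e : Real.log (157 / 156) = Real.log 157 - (2 * Real.log 2 + Real.log 3 + Real.log 13) := by
    rw [Real.log_div (by norm_num) (by norm_num), show (156 : ℝ) = 2 ^ 2 * 3 * 13 by norm_num, Real.log_mul (by norm_num) (by norm_num), Real.log_mul (by norm_num) (by norm_num), Real.log_pow]
    push_cast; ring
  rw [e] at z
  have h2 := Literature.Analysis.SpecialFunctions.Real.log_two_lt_d20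
  have h3 := log_three_le_logThreeHi
  rw [logThreeHi] at h3
  push_cast at h3
  have h13 := log_thirteen_le_logThirteenHi
  rw [logThirteenHi] at h13
  push_cast at h13
  obtain ⟨z1, z2⟩ := abs_le.1 z
  linarith

/-- lower decimal of `log 157` (fine) -/
def logHundredFiftySevenLo11 : ℚ := 505624580524 / 100000000000
/-- upper decimal of `log 157` -/
def logHundredFiftySevenHi11 : ℚ := 505624580546 / 100000000000
/-- `logHundredFiftySevenLo11 ≤ log 157`. -/
theorem logHundredFiftySevenLo11_le : (logHundredFiftySevenLo11 : ℝ) ≤ Real.log 157 := by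
  rw [logHundredFiftySevenLo11]; push_cast; linarith [log_hundredfiftyseven_gt]
/-- `log 157 ≤ logHundredFiftySevenHi11`. -/
theorem log_hundredfiftyseven_le_logHundredFiftySevenHi11 : Real.log 157 ≤ (logHundredFiftySevenHi11 : ℝ) := by
  rw [logHundredFiftySevenHi11]; push_cast; linarith [log_hundredfiftyseven_lt]
/-- `12.529964086141668 ≤ √157 ≤ 12.529964086141668`. -/
def sqrtHundredFiftySevenLo : ℚ := 125299640861416677 / 10000000000000000
/-- upper decimal of `√157` -/
def sqrtHundredFiftySevenHi : ℚ := 125299640861416678 / 10000000000000000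
/-- The atom `157`: weight `log 157/√157`. -/
def atomHundredFiftySeven : ℕ × AtomQ :=
  (157, ⟨logHundredFiftySevenLo11, logHundredFiftySevenHi11, logHundredFiftySevenLo11 / sqrtHundredFiftySevenHi, logHundredFiftySevenHi11 / sqrtHundredFiftySevenLo⟩)
/-- `atomHundredFiftySeven` encloses the atom `157` for any `S ∋ 157`. -/
theorem atomHundredFiftySeven_encl {S : Finset ℕ} (h : 157 ∈ S) :
    (atomHundredFiftySeven.2.lo : ℝ) ≤ Real.log atomHundredFiftySeven.1 ∧ Real.log atomHundredFiftySeven.1 ≤ (atomHundredFiftySeven.2.hi : ℝ) ∧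
      (atomHundredFiftySeven.2.wlo : ℝ) ≤ weilSemilocalCoeff S atomHundredFiftySeven.1 ∧
      weilSemilocalCoeff S atomHundredFiftySeven.1 ≤ (atomHundredFiftySeven.2.whi : ℝ) := by
  simp only [atomHundredFiftySeven]
  push_cast
  have h0 := prime_atom_encl (by norm_num : Nat.Prime 157) h (lo := logHundredFiftySevenLo11) (hi := logHundredFiftySevenHi11)
    (slo := sqrtHundredFiftySevenLo) (shi := sqrtHundredFiftySevenHi) (by exact_mod_cast logHundredFiftySevenLo11_le)
    (by exact_mod_cast log_hundredfiftyseven_le_logHundredFiftySevenHi11) (by rw [logHundredFiftySevenLo11]; norm_num)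
    (ratCast_le_sqrt (by rw [sqrtHundredFiftySevenLo]; norm_num) (by rw [sqrtHundredFiftySevenLo]; norm_num))
    (sqrt_le_ratCast (by rw [sqrtHundredFiftySevenHi]; norm_num) (by rw [sqrtHundredFiftySevenHi]; norm_num))
    (by rw [sqrtHundredFiftySevenLo]; norm_num)
  push_cast at h0
  exact h0

/-! ### The atom `163` (`log 163` from `163 = 162·(1 + 1/162)`) -/

/-- `(5.09375020041) < log 163` (`Real.abs_log_sub_add_sum_range_le` at `x = -1/162`, 7 terms). -/
theorem log_hundredsixtythree_gt : (5.09375020041 : ℝ) < Real.log 163 := by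
  have t : |(-(1 : ℝ) / 162)| < 1 := by rw [abs_of_neg (by norm_num)]; norm_num
  have z := Real.abs_log_sub_add_sum_range_le t 7
  rw [show |(-(1 : ℝ) / 162)| = 1 / 162 by rw [abs_of_neg (by norm_num)]; norm_num] at z
  norm_num [Finset.sum_range_succ] at z
  have e : Real.log (163 / 162) = Real.log 163 - (Real.log 2 + 4 * Real.log 3) := by
    rw [Real.log_div (by norm_num) (by norm_num), show (162 : ℝ) = 2 * 3 ^ 4 by norm_num, Real.log_mul (by norm_num) (by norm_num), Real.log_pow]
    push_cast; ring
  rw [e] at z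
  have h2 := Literature.Analysis.SpecialFunctions.Real.log_two_gt_d20
  have h3 := logThreeLo_le
  rw [logThreeLo] at h3
  push_cast at h3
  obtain ⟨z1, z2⟩ := abs_le.1 z
  linarith

/-- `log 163 < 5.09375020122` (`Real.abs_log_sub_add_sum_range_le` at `x = -1/162`, 7 terms). -/
theorem log_hundredsixtythree_lt : Real.log 163 < 5.09375020122 := by
  have t : |(-(1 : ℝ) / 162)| < 1 := by rw [abs_of_neg (by norm_num)]; norm_num
  have z := Real.abs_log_sub_add_sum_range_le t 7
  rw [show |(-(1 : ℝ) / 162)| = 1 / 162 by rw [abs_of_neg (by norm_num)]; norm_num] at z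
  norm_num [Finset.sum_range_succ] at z
  have e : Real.log (163 / 162) = Real.log 163 - (Real.log 2 + 4 * Real.log 3) := by
    rw [Real.log_div (by norm_num) (by norm_num), show (162 : ℝ) = 2 * 3 ^ 4 by norm_num, Real.log_mul (by norm_num) (by norm_num), Real.log_pow]
    push_cast; ring
  rw [e] at z
  have h2 := Literature.Analysis.SpecialFunctions.Real.log_two_lt_d20
  have h3 := log_three_le_logThreeHi
  rw [logThreeHi] at h3
  push_cast at h3
  obtain ⟨z1, z2⟩ := abs_le.1 z
  linarith

/-- lower decimal of `log 163` (fine) -/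
def logHundredSixtyThreeLo11 : ℚ := 509375020041 / 100000000000
/-- upper decimal of `log 163` -/
def logHundredSixtyThreeHi11 : ℚ := 509375020122 / 100000000000
/-- `logHundredSixtyThreeLo11 ≤ log 163`. -/
theorem logHundredSixtyThreeLo11_le : (logHundredSixtyThreeLo11 : ℝ) ≤ Real.log 163 := by
  rw [logHundredSixtyThreeLo11]; push_cast; linarith [log_hundredsixtythree_gt]
/-- `log 163 ≤ logHundredSixtyThreeHi11`. -/
theorem log_hundredsixtythree_le_logHundredSixtyThreeHi11 : Real.log 163 ≤ (logHundredSixtyThreeHi11 : ℝ) := by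
  rw [logHundredSixtyThreeHi11]; push_cast; linarith [log_hundredsixtythree_lt]
/-- `12.767145334803704 ≤ √163 ≤ 12.767145334803704`. -/
def sqrtHundredSixtyThreeLo : ℚ := 127671453348037046 / 10000000000000000
/-- upper decimal of `√163` -/
def sqrtHundredSixtyThreeHi : ℚ := 127671453348037047 / 10000000000000000
/-- The atom `163`: weight `log 163/√163`. -/
def atomHundredSixtyThree : ℕ × AtomQ :=
  (163, ⟨logHundredSixtyThreeLo11, logHundredSixtyThreeHi11, logHundredSixtyThreeLo11 / sqrtHundredSixtyThreeHi, logHundredSixtyThreeHi11 / sqrtHundredSixtyThreeLo⟩)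
/-- `atomHundredSixtyThree` encloses the atom `163` for any `S ∋ 163`. -/
theorem atomHundredSixtyThree_encl {S : Finset ℕ} (h : 163 ∈ S) :
    (atomHundredSixtyThree.2.lo : ℝ) ≤ Real.log atomHundredSixtyThree.1 ∧ Real.log atomHundredSixtyThree.1 ≤ (atomHundredSixtyThree.2.hi : ℝ) ∧
      (atomHundredSixtyThree.2.wlo : ℝ) ≤ weilSemilocalCoeff S atomHundredSixtyThree.1 ∧
      weilSemilocalCoeff S atomHundredSixtyThree.1 ≤ (atomHundredSixtyThree.2.whi : ℝ) := by
  simp only [atomHundredSixtyThree]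
  push_cast
  have h0 := prime_atom_encl (by norm_num : Nat.Prime 163) h (lo := logHundredSixtyThreeLo11) (hi := logHundredSixtyThreeHi11)
    (slo := sqrtHundredSixtyThreeLo) (shi := sqrtHundredSixtyThreeHi) (by exact_mod_cast logHundredSixtyThreeLo11_le)
    (by exact_mod_cast log_hundredsixtythree_le_logHundredSixtyThreeHi11) (by rw [logHundredSixtyThreeLo11]; norm_num)
    (ratCast_le_sqrt (by rw [sqrtHundredSixtyThreeLo]; norm_num) (by rw [sqrtHundredSixtyThreeLo]; norm_num))
    (sqrt_le_ratCast (by rw [sqrtHundredSixtyThreeHi]; norm_num) (by rw [sqrtHundredSixtyThreeHi]; norm_num))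
    (by rw [sqrtHundredSixtyThreeLo]; norm_num)
  push_cast at h0
  exact h0

/-! ### The atom `167` (`log 167` from `167 = 168·(1 − 1/168)`) -/

/-- `(5.11799381231) < log 167` (`Real.abs_log_sub_add_sum_range_le` at `x = 1/168`, 7 terms). -/
theorem log_hundredsixtyseven_gt : (5.11799381231 : ℝ) < Real.log 167 := by
  have t : |((1 : ℝ) / 168)| < 1 := by rw [abs_of_pos (by norm_num)]; norm_num
  have z := Real.abs_log_sub_add_sum_range_le t 7
  rw [abs_of_pos (by norm_num : (0 : ℝ) < 1 / 168)] at z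
  norm_num [Finset.sum_range_succ] at z
  have e : Real.log (167 / 168) = Real.log 167 - (3 * Real.log 2 + Real.log 3 + Real.log 7) := by
    rw [Real.log_div (by norm_num) (by norm_num), show (168 : ℝ) = 2 ^ 3 * 3 * 7 by norm_num, Real.log_mul (by norm_num) (by norm_num), Real.log_mul (by norm_num) (by norm_num), Real.log_pow]
    push_cast; ring
  rw [e] at z
  have h2 := Literature.Analysis.SpecialFunctions.Real.log_two_gt_d20
  have h3 := logThreeLo_le
  rw [logThreeLo] at h3
  push_cast at h3
  have h7 := logSevenLo_le
  rw [logSevenLo] at h7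
  push_cast at h7
  obtain ⟨z1, z2⟩ := abs_le.1 z
  linarith

/-- `log 167 < 5.11799381253` (`Real.abs_log_sub_add_sum_range_le` at `x = 1/168`, 7 terms). -/
theorem log_hundredsixtyseven_lt : Real.log 167 < 5.11799381253 := by
  have t : |((1 : ℝ) / 168)| < 1 := by rw [abs_of_pos (by norm_num)]; norm_num
  have z := Real.abs_log_sub_add_sum_range_le t 7
  rw [abs_of_pos (by norm_num : (0 : ℝ) < 1 / 168)] at z
  norm_num [Finset.sum_range_succ] at z
  have e : Real.log (167 / 168) = Real.log 167 - (3 * Real.log 2 + Real.log 3 + Real.log 7) := by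
    rw [Real.log_div (by norm_num) (by norm_num), show (168 : ℝ) = 2 ^ 3 * 3 * 7 by norm_num, Real.log_mul (by norm_num) (by norm_num), Real.log_mul (by norm_num) (by norm_num), Real.log_pow]
    push_cast; ring
  rw [e] at z
  have h2 := Literature.Analysis.SpecialFunctions.Real.log_two_lt_d20
  have h3 := log_three_le_logThreeHi
  rw [logThreeHi] at h3
  push_cast at h3
  have h7 := log_seven_le_logSevenHi
  rw [logSevenHi] at h7
  push_cast at h7
  obtain ⟨z1, z2⟩ := abs_le.1 z
  linarith

/-- lower decimal of `log 167` (fine) -/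
def logHundredSixtySevenLo11 : ℚ := 511799381231 / 100000000000
/-- upper decimal of `log 167` -/
def logHundredSixtySevenHi11 : ℚ := 511799381253 / 100000000000
/-- `logHundredSixtySevenLo11 ≤ log 167`. -/
theorem logHundredSixtySevenLo11_le : (logHundredSixtySevenLo11 : ℝ) ≤ Real.log 167 := by
  rw [logHundredSixtySevenLo11]; push_cast; linarith [log_hundredsixtyseven_gt]
/-- `log 167 ≤ logHundredSixtySevenHi11`. -/
theorem log_hundredsixtyseven_le_logHundredSixtySevenHi11 : Real.log 167 ≤ (logHundredSixtySevenHi11 : ℝ) := by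
  rw [logHundredSixtySevenHi11]; push_cast; linarith [log_hundredsixtyseven_lt]
/-- `12.922847983320086 ≤ √167 ≤ 12.922847983320086`. -/
def sqrtHundredSixtySevenLo : ℚ := 129228479833200854 / 10000000000000000
/-- upper decimal of `√167` -/
def sqrtHundredSixtySevenHi : ℚ := 129228479833200855 / 10000000000000000
/-- The atom `167`: weight `log 167/√167`. -/
def atomHundredSixtySeven : ℕ × AtomQ :=
  (167, ⟨logHundredSixtySevenLo11, logHundredSixtySevenHi11, logHundredSixtySevenLo11 / sqrtHundredSixtySevenHi, logHundredSixtySevenHi11 / sqrtHundredSixtySevenLo⟩)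
/-- `atomHundredSixtySeven` encloses the atom `167` for any `S ∋ 167`. -/
theorem atomHundredSixtySeven_encl {S : Finset ℕ} (h : 167 ∈ S) :
    (atomHundredSixtySeven.2.lo : ℝ) ≤ Real.log atomHundredSixtySeven.1 ∧ Real.log atomHundredSixtySeven.1 ≤ (atomHundredSixtySeven.2.hi : ℝ) ∧
      (atomHundredSixtySeven.2.wlo : ℝ) ≤ weilSemilocalCoeff S atomHundredSixtySeven.1 ∧
      weilSemilocalCoeff S atomHundredSixtySeven.1 ≤ (atomHundredSixtySeven.2.whi : ℝ) := by
  simp only [atomHundredSixtySeven]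
  push_cast
  have h0 := prime_atom_encl (by norm_num : Nat.Prime 167) h (lo := logHundredSixtySevenLo11) (hi := logHundredSixtySevenHi11)
    (slo := sqrtHundredSixtySevenLo) (shi := sqrtHundredSixtySevenHi) (by exact_mod_cast logHundredSixtySevenLo11_le)
    (by exact_mod_cast log_hundredsixtyseven_le_logHundredSixtySevenHi11) (by rw [logHundredSixtySevenLo11]; norm_num)
    (ratCast_le_sqrt (by rw [sqrtHundredSixtySevenLo]; norm_num) (by rw [sqrtHundredSixtySevenLo]; norm_num))
    (sqrt_le_ratCast (by rw [sqrtHundredSixtySevenHi]; norm_num) (by rw [sqrtHundredSixtySevenHi]; norm_num))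
    (by rw [sqrtHundredSixtySevenLo]; norm_num)
  push_cast at h0
  exact h0

/-! ### The atom `173` (`log 173` from `173 = 175·(1 − 2/175)`) -/

/-- `(5.15329159428) < log 173` (`Real.abs_log_sub_add_sum_range_le` at `x = 2/175`, 7 terms). -/
theorem log_hundredseventythree_gt : (5.15329159428 : ℝ) < Real.log 173 := by
  have t : |((2 : ℝ) / 175)| < 1 := by rw [abs_of_pos (by norm_num)]; norm_num
  have z := Real.abs_log_sub_add_sum_range_le t 7
  rw [abs_of_pos (by norm_num : (0 : ℝ) < 2 / 175)] at z
  norm_num [Finset.sum_range_succ] at z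
  have e : Real.log (173 / 175) = Real.log 173 - (2 * Real.log 5 + Real.log 7) := by
    rw [Real.log_div (by norm_num) (by norm_num), show (175 : ℝ) = 5 ^ 2 * 7 by norm_num, Real.log_mul (by norm_num) (by norm_num), Real.log_pow]
    push_cast; ring
  rw [e] at z
  have h5 := logFiveLo_le
  rw [logFiveLo] at h5
  push_cast at h5
  have h7 := logSevenLo_le
  rw [logSevenLo] at h7
  push_cast at h7
  obtain ⟨z1, z2⟩ := abs_le.1 z
  linarith

/-- `log 173 < 5.15329159470` (`Real.abs_log_sub_add_sum_range_le` at `x = 2/175`, 7 terms). -/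
theorem log_hundredseventythree_lt : Real.log 173 < 5.15329159470 := by
  have t : |((2 : ℝ) / 175)| < 1 := by rw [abs_of_pos (by norm_num)]; norm_num
  have z := Real.abs_log_sub_add_sum_range_le t 7
  rw [abs_of_pos (by norm_num : (0 : ℝ) < 2 / 175)] at z
  norm_num [Finset.sum_range_succ] at z
  have e : Real.log (173 / 175) = Real.log 173 - (2 * Real.log 5 + Real.log 7) := by
    rw [Real.log_div (by norm_num) (by norm_num), show (175 : ℝ) = 5 ^ 2 * 7 by norm_num, Real.log_mul (by norm_num) (by norm_num), Real.log_pow]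
    push_cast; ring
  rw [e] at z
  have h5 := log_five_le_logFiveHi
  rw [logFiveHi] at h5
  push_cast at h5
  have h7 := log_seven_le_logSevenHi
  rw [logSevenHi] at h7
  push_cast at h7
  obtain ⟨z1, z2⟩ := abs_le.1 z
  linarith

/-- lower decimal of `log 173` (fine) -/
def logHundredSeventyThreeLo11 : ℚ := 515329159428 / 100000000000
/-- upper decimal of `log 173` -/
def logHundredSeventyThreeHi11 : ℚ := 515329159470 / 100000000000
/-- `logHundredSeventyThreeLo11 ≤ log 173`. -/
theorem logHundredSeventyThreeLo11_le : (logHundredSeventyThreeLo11 : ℝ) ≤ Real.log 173 := by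
  rw [logHundredSeventyThreeLo11]; push_cast; linarith [log_hundredseventythree_gt]
/-- `log 173 ≤ logHundredSeventyThreeHi11`. -/
theorem log_hundredseventythree_le_logHundredSeventyThreeHi11 : Real.log 173 ≤ (logHundredSeventyThreeHi11 : ℝ) := by
  rw [logHundredSeventyThreeHi11]; push_cast; linarith [log_hundredseventythree_lt]
/-- `13.152946437965905 ≤ √173 ≤ 13.152946437965905`. -/
def sqrtHundredSeventyThreeLo : ℚ := 131529464379659054 / 10000000000000000
/-- upper decimal of `√173` -/
def sqrtHundredSeventyThreeHi : ℚ := 131529464379659055 / 10000000000000000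
/-- The atom `173`: weight `log 173/√173`. -/
def atomHundredSeventyThree : ℕ × AtomQ :=
  (173, ⟨logHundredSeventyThreeLo11, logHundredSeventyThreeHi11, logHundredSeventyThreeLo11 / sqrtHundredSeventyThreeHi, logHundredSeventyThreeHi11 / sqrtHundredSeventyThreeLo⟩)
/-- `atomHundredSeventyThree` encloses the atom `173` for any `S ∋ 173`. -/
theorem atomHundredSeventyThree_encl {S : Finset ℕ} (h : 173 ∈ S) :
    (atomHundredSeventyThree.2.lo : ℝ) ≤ Real.log atomHundredSeventyThree.1 ∧ Real.log atomHundredSeventyThree.1 ≤ (atomHundredSeventyThree.2.hi : ℝ) ∧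
      (atomHundredSeventyThree.2.wlo : ℝ) ≤ weilSemilocalCoeff S atomHundredSeventyThree.1 ∧
      weilSemilocalCoeff S atomHundredSeventyThree.1 ≤ (atomHundredSeventyThree.2.whi : ℝ) := by
  simp only [atomHundredSeventyThree]
  push_cast
  have h0 := prime_atom_encl (by norm_num : Nat.Prime 173) h (lo := logHundredSeventyThreeLo11) (hi := logHundredSeventyThreeHi11)
    (slo := sqrtHundredSeventyThreeLo) (shi := sqrtHundredSeventyThreeHi) (by exact_mod_cast logHundredSeventyThreeLo11_le)
    (by exact_mod_cast log_hundredseventythree_le_logHundredSeventyThreeHi11) (by rw [logHundredSeventyThreeLo11]; norm_num)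
    (ratCast_le_sqrt (by rw [sqrtHundredSeventyThreeLo]; norm_num) (by rw [sqrtHundredSeventyThreeLo]; norm_num))
    (sqrt_le_ratCast (by rw [sqrtHundredSeventyThreeHi]; norm_num) (by rw [sqrtHundredSeventyThreeHi]; norm_num))
    (by rw [sqrtHundredSeventyThreeLo]; norm_num)
  push_cast at h0
  exact h0


/-! ### The power atom `169 = 13²` (first needed at `N ≥ 169`) -/

/-- The atom `169 = 13²`: `log 169 = 2 log 13`, weight `log 13/13`. -/
def atomHundredSixtyNine : ℕ × AtomQ := (169, ⟨2 * logThirteenLo, 2 * logThirteenHi, logThirteenLo / 13, logThirteenHi / 13⟩)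
/-- `atomHundredSixtyNine` encloses the atom `169` for any `S ∋ 13`. -/
theorem atomHundredSixtyNine_encl {S : Finset ℕ} (h : 13 ∈ S) :
    (atomHundredSixtyNine.2.lo : ℝ) ≤ Real.log atomHundredSixtyNine.1 ∧
      Real.log atomHundredSixtyNine.1 ≤ (atomHundredSixtyNine.2.hi : ℝ) ∧
      (atomHundredSixtyNine.2.wlo : ℝ) ≤ weilSemilocalCoeff S atomHundredSixtyNine.1 ∧
      weilSemilocalCoeff S atomHundredSixtyNine.1 ≤ (atomHundredSixtyNine.2.whi : ℝ) := by
  simp only [atomHundredSixtyNine]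
  rw [show (169 : ℕ) = 13 ^ 2 by norm_num]
  have e169 : Real.sqrt ((13 ^ 2 : ℕ) : ℝ) = 13 := by
    rw [show ((13 ^ 2 : ℕ) : ℝ) = (13 : ℝ) ^ 2 by norm_num, Real.sqrt_sq (by norm_num)]
  have h0 := pow_atom_encl_of_bounds (by norm_num : Nat.Prime 13) two_ne_zero h (lo := logThirteenLo) (hi := logThirteenHi)
    (slo := 13) (shi := 13) (by exact_mod_cast logThirteenLo_le) (by exact_mod_cast log_thirteen_le_logThirteenHi)
    (by rw [logThirteenLo]; norm_num) (by rw [e169]; norm_num) (by rw [e169]; norm_num) (by norm_num)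
  push_cast at h0 ⊢
  exact h0

end Summit.RiemannHypothesis.RiemannHypothesis.Theorems.SemilocalPolyWitness

end
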